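import Literature.NumberTheory.EllipticCurves.TianYuanZhang2017.CMPointSevenBlockDisplays
import Literature.NumberTheory.EllipticCurves.HeegnerPoints
import HarnessLib

/-!
# Tian–Yuan–Zhang 2017 §3.1–3.2: the CM VALUE of a block `d ≡ 7 (mod 8)` — `z_d = i₀(P_d)`, `P_d = Γ₀(32)·τ_d` the level-`32`
# Heegner point of `K_d`, `i₀ : (X₀(32), ∞) ⥲ A` the identification — DISPLAY (S4) refining `CMPointSevenBlockDisplays` (one predicate, one named fact)

Companion to `CMPointSevenBlockDisplays.lean` (predicate `GenusPointData.SevenBlockCMSpec D d` = (S1)–(S3): the CM-point layer of a block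
`d ≡ 7 (mod 8)` read in a number field `M ⊇ ℍ′_n` as an ABSTRACT point `z ∈ A(M)` with `ι(Z(d)) = Σ_{t∈Φ} z^t`, no `z^t` a cusp, automorphisms
trivial on `L_d(i)` permuting the `z^t`; named fact `tyz_sevenBlockCMData`).  THE GAP THIS FILE CLOSES (crux `stmt-BirchSwinnertonDyer-20509`,
LEAD memo `Lines/offtyz_v7_SecondNorm.md` §8: «without (S4) no amount of class field theory reaches `x₀`»): (S1)–(S3) never say WHICH point `z`
is.  The source does: for `n ≡ 7 (mod 8)` the test vector is «the identity map `i₀ : X₀(32) → A`» (p0010 L39) of «the elliptic curve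
`A : 2y² = x³ + x` …, which is isomorphic to `(X₀(32), ∞)`.  Fix an identification `i₀ : (X₀(32), ∞) → A`» (p0010 L11–L12; «`i₀` (mapping `∞`
to `0`)», p0012 L8); `K_n = ℚ(√−n)` is embedded in `M₂(ℚ)` by «`√−n ⟼ (δ, 2; −(n+δ²)/2, −δ)` … Here `δ` is an integer such that
`δ² ≡ −n (mod 128)`» (p0010 L47–L50; «the embedding gives `𝒪̂_K^× ⊂ U₀(32)`», L52); «`P_n = [h, 1] ∈ X_U(ℂ)` be the CM point, where
`h ∈ ℋ^{K_n^×}` is the unique fixed point of `K_n^×` in `ℋ`» (p0010 L85–L88); «`z_n = f_n(P_n) ∈ A(K_n^{ab})`» (p0010 L89); and for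
`n ≡ 7 (mod 8)` «`H′_n = H_n`» (Prop. 3.2 (3), p0010 L111), `U = U₀(32)`, `X_U = X₀(32)` (Prop. 3.1 (2), p0010 L70–L71).  The fixed point of
`(δ, 2; −(n+δ²)/2, −δ)` acting on `ℋ` is the root in `ℋ` of `−((n+δ²)/2)τ² − 2δτ − 2 = 0`, i.e. of the PRIMITIVE positive definite form
`Q_{n,δ} = ((n+δ²)/4, δ, 1)` of discriminant `δ² − (n+δ²) = −n` with `32 ∣ (n+δ²)/4`: `h = τ_{Q_{n,δ}} = (−δ + √−n)/((n+δ²)/2)`, a Heegner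
point on `ℋ` of level `32` and discriminant `−n = d_{K_n}` in the tree's sense (`heegnerTau`, `heegnerForms 32 (−n)` of `HeegnerPoints.lean`).

**(S4) THE CM-VALUE SENTENCE, in currency (S4-φ)** (the pen's SUMMON 2026-08-31T03:11:49Z (A2); posted to cruxlead g31 at CLAIM time): for the
realisation `(M, ι, z, Φ)` of (S) at a block `d ≡ 7 (mod 8)` there are an embedding `ȷ : M → ℂ`, an integer `δ` with `128 ∣ d + δ²`, and a
modular parametrisation datum `Dt : ModularParametrizationData curveA 32` (the tree's carrier of `φ : X₀(N) → E`, `ModularCurve.lean`; `Dt.φ τ =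
uniformize (c · 2πi ∫_{i∞}^τ f)`, `∞ ↦ O`) OF MODULAR DEGREE `1` — an IDENTIFICATION `X₀(32) ⥲ A` mapping `∞` to `O`, i.e. the source's `i₀` up to
the sign `Aut_ℚ(A, O) = {±1}` (both signs are data of this type: `c ↦ −c`) — with **`ȷ(z) = Dt.φ (τ_{Q_{d,δ}})`** in `A(ℂ)`.  So `X := x ∘ Dt.φ`,
the `x`-coordinate of `A = [0,0,0,4,0]` along `X₀(32)(ℂ) = Γ₀(32)\ℋ* → A(ℂ)`, does not depend on the sign, and (S4) gives the kernel's sentence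
«`ȷ(x₀) = X(τ_d)`» for `z = (x₀, y₀)` (`SevenBlockCMValue.exists_map_x`, Proofs sibling).  The predicate `SevenBlockCMValueSpec D d` is (S1)–(S3) of
the sibling VERBATIM ∧ (S4) on the same objects; ONE named fact `tyz_sevenBlockCMValueData` refines `tyz_sevenBlockCMData` (implication
`tyz_sevenBlockCMData_of_sevenBlockCMValueData`, Proofs sibling `CMPointSevenBlockValueDisplaysProofs.lean`, where also
`sevenBlockForm_mem_heegnerForms : Q_{d,δ} ∈ heegnerForms 32 (−d)` and the existence of `δ` for `d ≡ 7 (mod 8)` are PROVED).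

WHY (S4-φ) AND NOT (S4-η).  The alternative currency «`X = s²`, `s = η(16τ)³/(η(8τ)η(32τ)²)`» (the η-quotient of
`XZeroThirtyTwoEtaQuotientSqrtX[Proofs].lean`) would need a PRINT source stating this parametrisation of `y² = x³ + 4x`; none was found
(presearch, corpus + galaxy: Ligozat 1975 prints the η-quotient unit group of `X₀(32)`, not the coordinate; g47).  The identity «`x ∘ Dt.φ = s²` for
`Dt` of degree `1`» is therefore a separate PROOF target (q-expansion comparison of two degree-`2` functions on the genus-`1` curve `X₀(32)` with
the same polar divisor `2(∞)`), NOT displayed and NOT asserted here.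

HONEST FRAMING: §1–§3 are a display (one predicate (S4) for the three printed sentences p0010 L39 / L47–L50 / L85–L89 read on the tree's
`heegnerTau` and `ModularParametrizationData.φ`, conjoined to the sibling's (S1)–(S3)) and ONE named fact; nothing in §1–§3 is asserted (no
`_holds`), no count moves; consumers take `(h : tyz_sevenBlockCMValueData)` as an explicit hypothesis.  Read into the tree's currency, «fix an
identification `i₀ : (X₀(32), ∞) → A`» becomes «a `ModularParametrizationData curveA 32` of modular degree `1`» — this uses that an isomorphism
`X₀(32) ⥲ A` over `ℚ` with `∞ ↦ O` pulls `ω_A` back to `c·2πi f(τ)dτ`, `f` the normalised newform of level `32`, with `c = ±1` (Manin constant of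
the `X₀(32)`-optimal curve `A`; Edixhoven 1991 §1, Cremona §2.10) — the one non-verbatim step of the display, flagged here.  NOT displayed: the
sign of `i₀`; the uniformisation `τ : ℂ/(1+i)ℤ[i] ⥲ A(ℂ)` and its cusp table (p0012 L1–L18); the conjugates `z^t = i₀(P_d^t)` as Heegner points of
the other classes (reached in the tree by `heegnerPoints_shimuraReciprocity_holds` / `ModularParametrizationData.isAutEquivariantOnHeegner`, ring
class layer, and by `ComplexMultiplication/ShimuraReciprocityExtendedRingClass.lean`, ray class layer); Prop. 3.2 (4); any VALUE `X(τ_d)`.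
Net debt of this file: +1 (a display; no research content).  Cell `bsd-print-cf2`, typer seat `-ty2` (g51).  BSD is not proved by any of
this; no class is closed by this file.

References: [TianYuanZhang2017] Y. Tian, X. Yuan, S.-W. Zhang, *Genus periods, genus points and congruent number problem*, Asian J. Math. 21
(2017) 721–774 = arXiv:1411.4728: §3.1 (chunk p0010 L11–L12, L39, L47–L52, L70–L71, L85–L92, L111; p0011 L53–L58), §3.2 (p0012 L8–L9);
[Gross1984] B. H. Gross, *Heegner points on X₀(N)*, §I.1 (Heegner points of level N); [EdixhovenManin1991] B. Edixhoven, *On the Manin constants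
of modular elliptic curves*, §1; [Cox2013] D. A. Cox, *Primes of the form x² + ny²* (2nd ed.), Thm. 7.7 (positive definite forms and ideals).
-/

noncomputable section

open scoped Classical

open WeierstrassCurve

namespace Literature.NumberTheory.EllipticCurves.TianYuanZhang2017

/-! ## §1 Vocabulary: TYZ's level-`32` Heegner form of `K_d` and the CM-value predicate (S4) -/

/-- **TYZ's Heegner form of level `32` for `K_d = ℚ(√−d)`, `d ≡ 7 (mod 8)`**: `Q_{d,δ} = ((d + δ²)/4, δ, 1)` for an integer `δ` with
`δ² ≡ −d (mod 128)` — the primitive positive definite form of discriminant `−d` whose root in `ℋ` is the fixed point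
`h = (−δ + √−d)/((d+δ²)/2)` of `K_d^×` embedded in `M₂(ℚ)` by `√−d ⟼ (δ, 2; −(d+δ²)/2, −δ)`; `32 ∣ (d+δ²)/4` («the embedding gives
`𝒪̂_K^× ⊂ U₀(32)`»).  For other `(d, δ)` the triple is junk (integer division).
[cite: TianYuanZhang2017, §3.1 (p0010 L47–L52, L85–L88)] [cite: Gross1984, §I.1] -/
def sevenBlockForm (d : ℕ) (δ : ℤ) : ℤ × ℤ × ℤ :=
  (((d : ℤ) + δ ^ 2) / 4, δ, 1)

/-- **(S4) The CM value of a block `d ≡ 7 (mod 8)`** (module docstring), for a point `z ∈ A(M)` of a field `M ⊇ ℚ`: there are an embedding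
`ȷ : M → ℂ`, an integer `δ` with `128 ∣ d + δ²` and a modular parametrisation datum `Dt` of `A = curveA` at level `32` of modular degree `1`
(the identification `i₀ : (X₀(32), ∞) ⥲ A`, up to sign) with `ȷ(z) = Dt.φ(τ_{Q_{d,δ}})` — «`z_d = f_d(P_d)`, `f_d = i₀`, `P_d = [h, 1]`, `h` the fixed
point of `K_d^×`».  A predicate; nothing asserted.
[cite: TianYuanZhang2017, §3.1 (p0010 L11–L12, L39, L47–L50, L85–L89), §3.2 (p0012 L8)] [cite: EdixhovenManin1991, §1] -/
def SevenBlockCMValue {M : Type} [Field M] [CharZero M] (z : APoint M) (d : ℕ) : Prop :=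
  ∃ (j : M →+* ℂ) (δ : ℤ) (Dt : ModularForms.ModularParametrizationData curveA 32),
    (128 : ℤ) ∣ (d : ℤ) + δ ^ 2 ∧ Dt.modularDegree = 1 ∧
      WeierstrassCurve.Affine.Point.map (W' := curveA) j.toRatAlgHom z = Dt.φ (heegnerTau (sevenBlockForm d δ))

namespace GenusPointData

variable {n : ℕ}

/-! ## §2 The printed sentences (S1)–(S4) for a block `d ≡ 7 (mod 8)`, read in an extension `M ⊇ ℍ′_n` -/

/-- **(S⁺) The CM-point layer of a block `d ≡ 7 (mod 8)` WITH ITS VALUE**: there are a number field `M`, Galois over `ℚ`, an embedding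
`ι : ℍ′_n → M`, a point `z ∈ A(M)` and a finite set `Φ ⊂ Aut_ℚ(M)` with (S1) `ι(Z(d)) = Σ_{t∈Φ} z^t` and `#Φ = g(d)`; (S2) no `z^t` is a cusp;
(S3) every automorphism of `M` trivial on `ι(L_d(i))` permutes the `z^t` — VERBATIM the sibling's `SevenBlockCMSpec` — and (S4) `z` is the CM
value `i₀(P_d)` (`SevenBlockCMValue z d`).  A predicate; nothing asserted.
[cite: TianYuanZhang2017, §3.1 (p0010 L11–L12, L39, L47–L50, L85–L92, L111; p0011 L1–L8, L53–L58), §3.2 (p0012 L8–L9), Lemma 3.16 (p0017 L98–L101), proof of Lemma 3.21 (p0020 L55–L63)]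
[cite: Cox2013, Thm. 6.1 and Lemma 9.3] -/
def SevenBlockCMValueSpec (D : GenusPointData n) (d : ℕ) : Prop :=
  ∃ (M : Type) (_ : Field M) (_ : NumberField M) (_ : IsGalois ℚ M) (ι : D.H →ₐ[ℚ] M) (z : APoint M) (Φ : Finset (M ≃ₐ[ℚ] M)),
    -- (S1) "Z(n) := Σ_{t∈Φ₀} f_n(P_n)^t", "Φ₀ ... a set of representatives of 2Cl_n" (σ = 1), "#Φ₀ = g(n)"
    (WeierstrassCurve.Affine.Point.map (W' := curveA) ι (D.Z d) = ∑ t ∈ Φ, galPtOver M t z ∧ Φ.card = gK d) ∧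
    -- (S2) the P_n^t are CM points of X_U, NOT cusps; "i₀ identifies the set of cusps with A[(1+i)³]"; A[(1+i)³] = {Q : 2Q ∈ {0, τ(1)}}
    (∀ t ∈ Φ, ¬ ((2 : ℕ) • galPtOver M t z = 0 ∨ (2 : ℕ) • galPtOver M t z = tauOne)) ∧
    -- (S3) "z_n ∈ A(H_n)" (H′_n = H_n), H_n/ℚ Galois, Φ₀ = 2Cl_n = Gal(H_n/L_n) a group: automorphisms trivial on L_d(i) permute the z^t
    (∀ g : M ≃ₐ[ℚ] M, D.TrivialOnLOver ι d g →
      ∃ π : Φ → Φ, Function.Bijective π ∧ ∀ t : Φ, galPtOver M g (galPtOver M (t : M ≃ₐ[ℚ] M) z) = galPtOver M (π t : M ≃ₐ[ℚ] M) z) ∧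
    -- (S4) "f_n = i₀ : (X₀(32), ∞) → A the identification", "P_n = [h, 1], h the fixed point of K_n^×", "z_n = f_n(P_n)"
    SevenBlockCMValue z d

/-- **(S⁺) at every block `d ∣ n`, `d ≡ 7 (mod 8)`.**  A predicate; nothing asserted.
[cite: TianYuanZhang2017, §3.1 (p0010 L39, L85–L89; p0011 L53–L66), Prop. 3.2 (3) (p0010 L111)] -/
def SevenBlockCMValuePrinted (D : GenusPointData n) : Prop :=
  ∀ d ∈ n.divisors, d % 8 = 7 → D.SevenBlockCMValueSpec d

end GenusPointData

/-! ## §3 The ONE named fact -/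

/-- **Tian–Yuan–Zhang 2017, §3 with the CM-point layer of ALL blocks AND THE CM VALUE of the blocks `d ≡ 7 (mod 8)` (`z_d = i₀(P_d)` read in
`ℂ` on the tree's `heegnerTau` / `ModularParametrizationData.φ`), the compositum sentence, Theorem 3.5 at the blocks, AS PRINTED, as ONE named
fact**: for every positive square-free `n ≡ 5, 6, 7 (mod 8)` there are data `D : GenusPointData n` satisfying `Printed`,
`CMPointCompositumPrinted`, `Thm35AtBlocks` and `SevenBlockCMValuePrinted`.  Constructed in the source from the CM points on `X_U → A`
(§3.1–3.2), Yuan–Zhang–Zhang's Gross–Zagier formula (Thm. 3.3) and class field theory, inside `ℚ̄ ⊂ ℂ` (so `ȷ` = the inclusion, `i₀ = ±Dt.φ`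
for a degree-`1` datum by the integrality `c = ±1` of the Manin constant of the `X₀(32)`-optimal curve `A`); no `_holds` expected.  Refines
`tyz_sevenBlockCMData` (`tyz_sevenBlockCMData_of_sevenBlockCMValueData`, Proofs sibling).  Consumers take it as an explicit hypothesis;
nothing is asserted here.
[cite: TianYuanZhang2017, §3: §3.1 (p0010 L11–L12, L36–L115, p0011 L1–L73), Prop. 3.2 (3), Prop. 3.4, Thm. 3.5, Thm. 3.6, Lemma 3.16, Lemma 3.18, Lemma 3.21 and its proof (p0020 L50–L63); §3.2 (p0012 L8–L9)]
[cite: EdixhovenManin1991, §1] [cite: Cox2013, Thm. 6.1 and Lemma 9.3] -/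
def tyz_sevenBlockCMValueData : Prop :=
  ∀ (n : ℕ), Squarefree n → (n % 8 = 5 ∨ n % 8 = 6 ∨ n % 8 = 7) →
    ∃ D : GenusPointData n, D.Printed ∧ D.CMPointCompositumPrinted ∧ D.Thm35AtBlocks ∧ D.SevenBlockCMValuePrinted

end Literature.NumberTheory.EllipticCurves.TianYuanZhang2017

end
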